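import Literature.AlgebraicGeometry.Resolution.KollarFunctorWellFounded
import HarnessLib

/-!
# Well-founded repetition of a one-blow-up step commutes with smooth morphisms (Kollár 2007, 3.34.1 for 3.111 Step 3)

Topic: `Literature/AlgebraicGeometry/Resolution`. Shared infrastructure for the decomposition of
the named fact `Kollar2007Thm3_107` (`KollarBlowupSequenceFunctors.lean`; J. Kollár, *Lectures on
Resolution of Singularities*, Ann. of Math. Stud. 166 (2007), 3.111 Step 3 with 3.34.1, pp. 131 and
177–178 of the held copy). The sequel of `KollarFunctorWellFounded.lean` announced there: the
passage of the functoriality 3.34.1 (smooth morphisms) from a ONE-BLOW-UP step `S` to its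
well-founded repetition `Kollar2007.wfIter` ("Repeating this, we eventually get …"; "The
functoriality conditions are just as obvious as before", p. 178).

The point (which is why this is not an instance of `KollarFunctorIteration.lean`): along a
NON-surjective smooth morphism `h : Y → X` (an open immersion, say) the pull-back of the centre
blown up by the step on `X` may be EMPTY on `Y`, and then the step on `Y` is not the pruned
pull-back of the step on `X` — it is (the pull-back of) a LATER step on `X`. So the comparison
cannot be made step by step; instead, by well-founded induction on the measure, the pull-back
`h^*𝓑(T) = h^*S(T) ⧺ (h_1)^*𝓑(T_1)` is shown to be an EXTENSION (BGMW Def. 3.1.5,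
`CentreSeq.IsExtensionOf`) of `𝓑(T')`, through the identity
`𝓑(T') = (h^*S(T)).prune ⧺ 𝓑(T'_q)` (`wfIter_eq_prune_append`: if `h^*Z ≠ ∅` the pruned pull-back
IS the step on `T'`; if `h^*Z = ∅` it is the empty sequence and the identity is tautological) and
the argument of `compStage_commutesWithSmoothMorphisms` (`KollarFunctorComposition.lean`) for the
rest; since `𝓑(T')` has no empty blow-ups it is then the pruning of `h^*𝓑(T)`
(`IsExtensionOf.prune_eq`). Hypotheses on the step, all satisfied by Step 3 of 3.111: its values
are empty or single blow-ups (`single`), with non-empty centres; "nothing to do" is stable under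
smooth pull-backs (`nilStable`); and a step whose centre pulls back to a NON-EMPTY centre pulls
back to the step (`stepComap`).

* `wfIter_comap_of_surjective` — 3.34.1, first bullet (smooth surjections: no centre becomes
  empty, `comap_eq_top_iff_of_surjective`);
* `wfIter_eq_prune_append` — the identity above, with the class of the triple at its top;
* `wfIter_isExtensionOf_comap` — `h^*𝓑(T)` is an extension of `𝓑(T')`;
* **`wfIter_commutesWithSmoothMorphisms`** — 3.34.1 for the repetition; `wfIter_isStageFunctor` —
  the repetition bundled as a stage (`Kollar2007.IsStageFunctor`) to the resolved triples.

## Sources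

* J. Kollár, *Lectures on Resolution of Singularities* (2007), 3.34.1 (p. 131), 3.32 (p. 130),
  3.111 Step 3 (pp. 177–178 of the held copy). [Kollar2007]
* E. Bierstone, D. Grigoriev, P. Milman, J. Włodarczyk, arXiv:1206.3090, Def. 3.1.5 (extensions)
  and Thm. 8.0.5 (2). [BierstoneGrigorievMilmanWlodarczyk2011]
-/

noncomputable section

open CategoryTheory CategoryTheory.Limits AlgebraicGeometry TopologicalSpace

namespace Literature.AlgebraicGeometry.Resolution

universe u

open Kollar2007 (removeEmpty)

namespace CentreSeq

variable {X Y : Scheme.{u}}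

/-- The pruning of a single blow-up with non-empty centre is itself. [folklore] -/
theorem prune_single_of_ne_top {C : X.IdealSheafData} (hC : C ≠ ⊤) : (single C).prune = single C := by
  rw [single, prune_cons_of_ne_top hC]
  rfl

/-- The pruning of a single EMPTY blow-up is the empty sequence. [folklore] -/
theorem prune_single_of_eq_top {C : X.IdealSheafData} (hC : C = ⊤) : (single C).prune = nil X := by
  rw [single, prune_cons_of_eq_top hC]
  rfl

/-- A single blow-up is not the empty sequence. [folklore] -/
theorem single_ne_nil (C : X.IdealSheafData) : single C ≠ nil X := fun h => by cases h

end CentreSeq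

namespace Kollar2007

variable {n m : ℕ} {σ : Type} {r : σ → σ → Prop}

section Smooth

variable (hwf : WellFounded r) (hm : 1 ≤ m) {𝒞 : TripleClass.{u} n} {S : BlowupSequenceFunctor.{u} n}
  {adm : ∀ ⦃k : Type u⦄ [Field k] [CharZero k] (T : Triple k n), 𝒞 T → (S T).IsAdmissibleFor (T.marked m)}
  {μ : ∀ ⦃k : Type u⦄ [Field k] [CharZero k], Triple k n → σ}
  {hdec : ∀ ⦃k : Type u⦄ [Field k] [CharZero k] (T : Triple k n) (hT : 𝒞 T),
    S T ≠ CentreSeq.nil T.X → r (μ (T.seqTop hm (S T) (adm T hT))) (μ T)}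
  (stable : ∀ ⦃k : Type u⦄ [Field k] [CharZero k] (T : Triple k n) (hT : 𝒞 T),
    𝒞 (T.seqTop hm (S T) (adm T hT)))
  (single : ∀ ⦃k : Type u⦄ [Field k] [CharZero k] (T : Triple k n), 𝒞 T →
    S T = CentreSeq.nil T.X ∨ ∃ C : T.X.IdealSheafData, S T = CentreSeq.single C)
  (noEmpty : ∀ ⦃k : Type u⦄ [Field k] [CharZero k] (T : Triple k n), 𝒞 T → (S T).NoEmptyCentres)
  (nilStable : ∀ ⦃k : Type u⦄ [Field k] [CharZero k] (T T' : Triple k n) (h : T'.X ⟶ T.X),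
    Smooth h → 𝒞 T → 𝒞 T' → T.IsPullbackAlong T' h → S T = CentreSeq.nil T.X →
      S T' = CentreSeq.nil T'.X)
  (stepComap : ∀ ⦃k : Type u⦄ [Field k] [CharZero k] (T T' : Triple k n) (h : T'.X ⟶ T.X),
    Smooth h → 𝒞 T → 𝒞 T' → T.IsPullbackAlong T' h → ∀ C : T.X.IdealSheafData,
      S T = CentreSeq.single C → C.comap h ≠ ⊤ → S T' = CentreSeq.single (C.comap h))
  (pb : ∀ ⦃k : Type u⦄ [Field k] [CharZero k] (T T' : Triple k n) (g : T'.X ⟶ T.X),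
    Smooth g → 𝒞 T → T.IsPullbackAlong T' g → 𝒞 T')

/-! ## 3.34.1, first bullet: smooth surjections -/

include single noEmpty nilStable stepComap in
/-- Along a smooth SURJECTION between triples of the class, the step pulls back to the step (no
centre becomes empty). [cite: Kollar2007, 3.34.1 (p. 131)] -/
theorem step_comap_of_surjective {k : Type u} [Field k] [CharZero k] (T T' : Triple k n)
    (h : T'.X ⟶ T.X) [Smooth h] [Surjective h] (hT : 𝒞 T) (hT' : 𝒞 T') (hpb : T.IsPullbackAlong T' h) :
    S T' = (S T).comap h := by
  rcases single T hT with hnil | ⟨C, hC⟩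
  · rw [nilStable T T' h ‹Smooth h› hT hT' hpb hnil, hnil]
    rfl
  · have hCtop : C ≠ ⊤ := by
      have h0 := noEmpty T hT
      rw [hC] at h0
      exact h0.1
    have hCtop' : C.comap h ≠ ⊤ := fun e => hCtop ((comap_eq_top_iff_of_surjective h C).mp e)
    rw [stepComap T T' h ‹Smooth h› hT hT' hpb C hC hCtop', hC, CentreSeq.comap_single]

include stable single noEmpty nilStable stepComap pb in
/-- **3.34.1, first bullet, for the repetition**: along a smooth surjection,
`𝓑(T') = h^*𝓑(T)` (`h^*(S(T) ⧺ 𝓑(T_1)) = S(T') ⧺ (h_1)^*𝓑(T_1)` and induction on the measure,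
`T'_1` being the pull-back of `T_1` along the smooth surjection `h_1`, `seqTop_isPullbackAlong`).
[cite: Kollar2007, 3.34.1 (p. 131)] -/
theorem wfIter_comap_of_surjective {k : Type u} [Field k] [CharZero k] (T T' : Triple k n)
    (h : T'.X ⟶ T.X) [Smooth h] [Surjective h] (hT : 𝒞 T) (hT' : 𝒞 T')
    (hpb : T.IsPullbackAlong T' h) :
    wfIter hwf hm 𝒞 S adm μ hdec T' = (wfIter hwf hm 𝒞 S adm μ hdec T).comap h := by
  suffices H : ∀ (l : σ) ⦃k : Type u⦄ [Field k] [CharZero k] (T T' : Triple k n) (h : T'.X ⟶ T.X),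
      Smooth h → Surjective h → μ T = l → 𝒞 T → 𝒞 T' → T.IsPullbackAlong T' h →
        wfIter hwf hm 𝒞 S adm μ hdec T' = (wfIter hwf hm 𝒞 S adm μ hdec T).comap h from
    H _ T T' h ‹Smooth h› ‹Surjective h› rfl hT hT' hpb
  intro l
  induction l using hwf.induction with
  | _ l IH =>
    intro k _ _ T T' h hs hsurj hl hT hT' hpb
    haveI := hs
    haveI := hsurj
    have e₁ : S T' = (S T).comap h :=
      step_comap_of_surjective single noEmpty nilStable stepComap T T' h hT hT' hpb
    by_cases hS0 : S T = CentreSeq.nil T.X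
    · have hS0' : S T' = CentreSeq.nil T'.X := by rw [e₁, hS0]; rfl
      rw [wfIter_apply_of_eq_nil hwf hm 𝒞 S adm μ hdec T hS0,
        wfIter_apply_of_eq_nil hwf hm 𝒞 S adm μ hdec T' hS0']
      rfl
    · have hS0' : S T' ≠ CentreSeq.nil T'.X := by
        rw [e₁]
        intro h0
        apply hS0
        cases hST : S T with
        | nil _ => rfl
        | cons C rest =>
          rw [hST] at h0
          exact absurd h0 (by simp [CentreSeq.comap])
      rw [wfIter_apply_of_ne_nil hwf hm 𝒞 S adm μ hdec T hT hS0,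
        wfIter_apply_of_ne_nil hwf hm 𝒞 S adm μ hdec T' hT' hS0', CentreSeq.comap_append]
      suffices H' : ∀ (q : CentreSeq T'.X) (hq : q.IsAdmissibleFor (T'.marked m)), q = (S T).comap h →
          q.append (wfIter hwf hm 𝒞 S adm μ hdec (T'.seqTop hm q hq)) =
            ((S T).comap h).append ((wfIter hwf hm 𝒞 S adm μ hdec (T.seqTop hm (S T) (adm T hT))).comap
              ((S T).comapι h)) from H' _ (adm T' hT') e₁
      rintro q hq rfl
      have hpb₁ := Triple.seqTop_isPullbackAlong hpb hm (S T) (adm T hT) hq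
      have hT₁ : 𝒞 (T.seqTop hm (S T) (adm T hT)) := stable T hT
      have hsc : Smooth ((S T).comapι h) := CentreSeq.smooth_comapι (S T) h
      have hT'₁ : 𝒞 (T'.seqTop hm ((S T).comap h) hq) := pb _ _ _ hsc hT₁ hpb₁
      exact congrArg _ (IH _ (hl ▸ hdec T hT hS0) _ _ _ hsc (CentreSeq.surjective_comapι (S T) h) rfl
        hT₁ hT'₁ hpb₁)

/-! ## `𝓑(T') = (h^*S(T)).prune ⧺ 𝓑(T'_q)` -/

include stable single stepComap in
/-- **The value on a pulled-back triple, split at the pruned pull-back of the first step**: along a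
smooth `h` with `T'` the pull-back of `T`, for `q = (h^*S(T)).prune` (a smooth blow-up sequence of
order `≥ m` for `(X', I', m, E')`): `𝓑(T') = q ⧺ 𝓑(T'_q)`, `T'_q` the triple at the top of `q`,
which lies in the class. If the centre `Z` of `S(T)` pulls back to a non-empty centre then
`q = h^*S(T) = S(T')` (`stepComap`) and this is the unfolding of the repetition; if `h^*Z = ∅`
then `q = ∅` and `T'_q = T'`. [cite: Kollar2007, 3.34.1 (p. 131) with 3.32 (p. 130)] -/
theorem wfIter_eq_prune_append {k : Type u} [Field k] [CharZero k] (T T' : Triple k n)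
    (h : T'.X ⟶ T.X) [Smooth h] (hT : 𝒞 T) (hT' : 𝒞 T') (hpb : T.IsPullbackAlong T' h) :
    ∃ hq : ((S T).comap h).prune.IsAdmissibleFor (T'.marked m),
      wfIter hwf hm 𝒞 S adm μ hdec T' =
        ((S T).comap h).prune.append (wfIter hwf hm 𝒞 S adm μ hdec (T'.seqTop hm ((S T).comap h).prune hq)) ∧
      𝒞 (T'.seqTop hm ((S T).comap h).prune hq) := by
  -- it suffices to treat a `q` propositionally equal to the pruned pull-back
  suffices H : ∀ (q : CentreSeq T'.X), q = ((S T).comap h).prune →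
      ∃ hq : q.IsAdmissibleFor (T'.marked m),
        wfIter hwf hm 𝒞 S adm μ hdec T' = q.append (wfIter hwf hm 𝒞 S adm μ hdec (T'.seqTop hm q hq)) ∧
        𝒞 (T'.seqTop hm q hq) from H _ rfl
  intro q hq
  rcases single T hT with hnil | ⟨C, hC⟩
  · -- nothing happens on `T`: `q = ∅`
    have e : q = CentreSeq.nil T'.X := by rw [hq, hnil]; rfl
    subst e
    refine ⟨trivial, ?_, ?_⟩
    · exact (eq_of_heq (Triple.heq_apply_of_eq (fun X : Triple k n => wfIter hwf hm 𝒞 S adm μ hdec X)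
        (Triple.seqTop_nil T' hm))).symm
    · show 𝒞 (T'.seqTop hm (CentreSeq.nil T'.X) trivial)
      rw [Triple.seqTop_nil]
      exact hT'
  · by_cases hCh : C.comap h = ⊤
    · -- the centre becomes empty: `q = ∅`
      have e : q = CentreSeq.nil T'.X := by
        rw [hq, hC, CentreSeq.comap_single, CentreSeq.prune_single_of_eq_top hCh]
      subst e
      refine ⟨trivial, ?_, ?_⟩
      · exact (eq_of_heq (Triple.heq_apply_of_eq (fun X : Triple k n => wfIter hwf hm 𝒞 S adm μ hdec X)
          (Triple.seqTop_nil T' hm))).symm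
      · show 𝒞 (T'.seqTop hm (CentreSeq.nil T'.X) trivial)
        rw [Triple.seqTop_nil]
        exact hT'
    · -- the centre stays non-empty: `q = h^*S(T) = S(T')`
      have hS' : S T' = CentreSeq.single (C.comap h) := stepComap T T' h ‹Smooth h› hT hT' hpb C hC hCh
      have e : q = S T' := by
        rw [hq, hC, CentreSeq.comap_single, CentreSeq.prune_single_of_ne_top hCh, hS']
      subst e
      have hne : S T' ≠ CentreSeq.nil T'.X := by rw [hS']; exact CentreSeq.single_ne_nil _
      exact ⟨adm T' hT', wfIter_apply_of_ne_nil hwf hm 𝒞 S adm μ hdec T' hT' hne, stable T' hT'⟩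

/-! ## 3.34.1, second bullet: `h^*𝓑(T)` is an extension of `𝓑(T')` -/

include stable single nilStable stepComap pb in
/-- **Along a smooth morphism `h` with `T'` the pull-back of `T`, `h^*𝓑(T)` is an extension of
`𝓑(T')`** (well-founded induction on the measure of `T`; the inductive step is the argument of
`compStage_commutesWithSmoothMorphisms` with `wfIter_eq_prune_append` in place of the
functoriality of the first factor: along the smooth `g = pruneι ≫ h_1 : (T'_q).X → (T_1).X`,
`g^*𝓑(T_1)` extends `𝓑(g^*T_1)` by induction, and `𝓑(g^*T_1) = 𝓑(T'_q)` because `g^*T_1` and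
`T'_q` differ by empty boundary members only, `transformMarked_prune`, clause (3) for the
repetition, `wfIter_ignoresEmptyDivisors`). [cite: Kollar2007, 3.34.1 (p. 131)] -/
theorem wfIter_isExtensionOf_comap (ign : IgnoresEmptyDivisors 𝒞 S) {k : Type u} [Field k] [CharZero k]
    (T T' : Triple k n) (h : T'.X ⟶ T.X) [Smooth h] (hT : 𝒞 T) (hT' : 𝒞 T')
    (hpb : T.IsPullbackAlong T' h) :
    ((wfIter hwf hm 𝒞 S adm μ hdec T).comap h).IsExtensionOf (wfIter hwf hm 𝒞 S adm μ hdec T') := by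
  suffices H : ∀ (l : σ) ⦃k : Type u⦄ [Field k] [CharZero k] (T T' : Triple k n) (h : T'.X ⟶ T.X),
      Smooth h → μ T = l → 𝒞 T → 𝒞 T' → T.IsPullbackAlong T' h →
        ((wfIter hwf hm 𝒞 S adm μ hdec T).comap h).IsExtensionOf (wfIter hwf hm 𝒞 S adm μ hdec T') from
    H _ T T' h ‹Smooth h› rfl hT hT' hpb
  intro l
  induction l using hwf.induction with
  | _ l IH =>
    intro k _ _ T T' h hs hl hT hT' hpb
    haveI := hs
    haveI : IsLocallyNoetherian T.X := T.isLocallyNoetherian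
    haveI : IsLocallyNoetherian T'.X := T'.isLocallyNoetherian
    by_cases hS0 : S T = CentreSeq.nil T.X
    · -- nothing happens on `T`, hence on `T'`
      have hS0' : S T' = CentreSeq.nil T'.X := nilStable T T' h hs hT hT' hpb hS0
      rw [wfIter_apply_of_eq_nil hwf hm 𝒞 S adm μ hdec T hS0,
        wfIter_apply_of_eq_nil hwf hm 𝒞 S adm μ hdec T' hS0']
      rfl
    · -- `𝓑(T) = S(T) ⧺ 𝓑(T₁)`; `𝓑(T') = (h^*S(T)).prune ⧺ 𝓑(T'_q)`
      have hsT : (S T).IsAdmissibleFor (T.marked m) := adm T hT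
      have hT₁ : 𝒞 (T.seqTop hm (S T) hsT) := stable T hT
      have hsc : Smooth ((S T).comapι h) := CentreSeq.smooth_comapι (S T) h
      obtain ⟨hq, eq', hT'q⟩ :=
        wfIter_eq_prune_append hwf hm stable single stepComap T T' h hT hT' hpb
      rw [wfIter_apply_of_ne_nil hwf hm 𝒞 S adm μ hdec T hT hS0, CentreSeq.comap_append, eq']
      refine CentreSeq.isExtensionOf_append_prune ((S T).comap h) _ _ ?_
      rw [← CentreSeq.comap_comp]
      -- along the smooth `g = pruneι ≫ h₁ : (T'_q).X ⟶ (T₁).X`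
      have hsg : Smooth (((S T).comap h).pruneι ≫ (S T).comapι h) := by
        haveI := CentreSeq.smooth_pruneι ((S T).comap h)
        haveI := hsc
        infer_instance
      have hprune := CentreSeq.transformMarked_prune ((S T).comap h) (T'.marked m)
      have hcomap : ((S T).comap h).transformMarked (T'.marked m) =
          ((S T).transformMarked (T.marked m)).comap ((S T).comapι h) :=
        hpb.transformMarked_comap m (S T)
      have hg : (((S T).comap h).pruneι ≫ (S T).comapι h) ≫ (T.seqTop hm (S T) hsT).struct =
          (T'.seqTop hm ((S T).comap h).prune hq).struct := by
        rw [Triple.seqTop_struct, Triple.seqTop_struct, Category.assoc,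
          ← Category.assoc ((S T).comapι h), ← CentreSeq.comap_comp_ι (S T) h, Category.assoc,
          hpb.comp_struct, ← Category.assoc, CentreSeq.pruneι_comp]
      have hI : (T'.seqTop hm ((S T).comap h).prune hq).ideal =
          (T.seqTop hm (S T) hsT).ideal.comap (((S T).comap h).pruneι ≫ (S T).comapι h) := by
        show (((S T).comap h).prune.transformMarked (T'.marked m)).ideal =
          ((S T).transformMarked (T.marked m)).ideal.comap (((S T).comap h).pruneι ≫ (S T).comapι h)
        rw [hprune.1, hcomap, MarkedIdeal.comap_ideal, Scheme.IdealSheafData.comap_comp]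
      have hpbc := (T.seqTop hm (S T) hsT).isPullbackAlong_comapOf
        (T'.seqTop hm ((S T).comap h).prune hq) _ hsg hg hI
      have hTc : 𝒞 ((T.seqTop hm (S T) hsT).comapOf (T'.seqTop hm ((S T).comap h).prune hq) _ hsg hg hI) :=
        pb (T.seqTop hm (S T) hsT) _ _ hsg hT₁ hpbc
      have hE : removeEmpty (T'.seqTop hm ((S T).comap h).prune hq).boundary =
          removeEmpty ((T.seqTop hm (S T) hsT).comapOf (T'.seqTop hm ((S T).comap h).prune hq) _
            hsg hg hI).boundary := by
        show removeEmpty (((S T).comap h).prune.transformMarked (T'.marked m)).boundary =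
          removeEmpty (((S T).transformMarked (T.marked m)).boundary.map fun D =>
            D.comap (((S T).comap h).pruneι ≫ (S T).comapι h))
        rw [hprune.2.2, hcomap, MarkedIdeal.comap_boundary, List.map_map]
        congr 1
        refine List.map_congr_left fun D _ => ?_
        exact (Scheme.IdealSheafData.comap_comp _ _ _).symm
      have eB : wfIter hwf hm 𝒞 S adm μ hdec (T'.seqTop hm ((S T).comap h).prune hq) =
          wfIter hwf hm 𝒞 S adm μ hdec
            ((T.seqTop hm (S T) hsT).comapOf (T'.seqTop hm ((S T).comap h).prune hq) _ hsg hg hI) :=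
        wfIter_ignoresEmptyDivisors hwf hm stable ign
          ((T.seqTop hm (S T) hsT).comapOf (T'.seqTop hm ((S T).comap h).prune hq) _ hsg hg hI)
          (T'.seqTop hm ((S T).comap h).prune hq).boundary
          (T'.seqTop hm ((S T).comap h).prune hq).hasSNC
          (T'.seqTop hm ((S T).comap h).prune hq).boundary_pairwise hE hTc hT'q
      rw [eB]
      exact IH _ (hl ▸ hdec T hT hS0) (T.seqTop hm (S T) hsT) _ _ hsg rfl hT₁ hTc hpbc

include stable single noEmpty nilStable stepComap pb in
/-- **3.34.1 for the well-founded repetition of a one-blow-up step**: `𝓑 = wfIter S` commutes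
with smooth morphisms on the class — first bullet `wfIter_comap_of_surjective`; second bullet:
`h^*𝓑(T)` is an extension of `𝓑(T')`, which has no empty blow-ups, hence
`𝓑(T') = (h^*𝓑(T)).prune` (`IsExtensionOf.prune_eq`). [cite: Kollar2007, 3.34.1 (p. 131) and 3.111 Step 3 (p. 178)] -/
theorem wfIter_commutesWithSmoothMorphisms (ign : IgnoresEmptyDivisors 𝒞 S) :
    CommutesWithSmoothMorphisms 𝒞 (wfIter hwf hm 𝒞 S adm μ hdec) := by
  intro k _ _ T T' h hs hT hT' hpb
  refine ⟨fun hsurj => ?_, ?_⟩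
  · exact wfIter_comap_of_surjective hwf hm stable single noEmpty nilStable stepComap pb T T' h hT hT' hpb
  · exact ((wfIter_isExtensionOf_comap hwf hm stable single nilStable stepComap pb ign T T' h hT
      hT' hpb).prune_eq (wfIter_noEmptyCentres hwf hm stable noEmpty T' hT')).symm

include stable single noEmpty nilStable stepComap pb in
/-- **The repetition of a one-blow-up step, as a stage to the resolved triples**: if moreover the
step stops only at resolved triples, commutes with changes of fields and ignores empty divisors
(and the class is invariant under changes of fields), then `wfIter S` is a stage
(`Kollar2007.IsStageFunctor`) from `𝒞` to `cosupp(I, m) = ∅` — the shape of Step 3 of 3.111.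
[cite: Kollar2007, 3.111 Step 3 (pp. 177–178) with Thm. 3.69 (p. 150)] -/
theorem wfIter_isStageFunctor (ign : IgnoresEmptyDivisors 𝒞 S) (commF : CommutesWithFieldChange 𝒞 S)
    (hclassF : ∀ ⦃K : Type u⦄ [Field K] [CharZero K] ⦃L : Type u⦄ [Field L] [CharZero L]
      (σ' : K →+* L) (T : Triple K n) (T' : Triple L n) (g : T'.X ⟶ T.X),
      Triple.IsFieldChange σ' T T' g → 𝒞 T → 𝒞 T')
    (post0 : ∀ ⦃k : Type u⦄ [Field k] [CharZero k] (T : Triple k n), 𝒞 T → S T = CentreSeq.nil T.X →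
      (T.marked m).support = ∅) :
    IsStageFunctor hm 𝒞 (TripleClass.resolved n m) (wfIter hwf hm 𝒞 S adm μ hdec) where
  adm _ _ _ T hT := wfIter_isAdmissibleFor hwf hm stable T hT
  noEmpty _ _ _ T hT := wfIter_noEmptyCentres hwf hm stable noEmpty T hT
  post _ _ _ T hT := wfIter_post hwf hm stable post0 T hT _
  comm := wfIter_commutesWithSmoothMorphisms hwf hm stable single noEmpty nilStable stepComap pb ign
  commF := wfIter_commutesWithFieldChange hwf hm stable commF hclassF
  ign := wfIter_ignoresEmptyDivisors hwf hm stable ign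

end Smooth

end Kollar2007

end Literature.AlgebraicGeometry.Resolution

end
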